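import Literature.Computability.Complexity.TVSelfCorrect
import Literature.Computability.Complexity.TVCheckerBricks
import Literature.Computability.Complexity.TVLengthLemmas
import HarnessLib

/-!
# The interpolation nodes of the corrector of Trevisan–Vadhan's `F` are the checker's nodes, shifted by one

Literature / complexity — derandomization (Case 2 of IW98 in TV07 form); a bridge lemma for the machine
of the corrector evaluator (`Ev'` of `UniformDerandomizationRSRBridge.lean`). The counting theory of the
corrector (`TVSelfCorrect.lean`) interpolates along a line at the nodes
`QBFUniv.nodes n a = GF2.elt (Mof n) (a + 1)` (the field element whose power-basis digits are the binary
digits of `a + 1`); the `FP` bricks of the downward checker (`TVCheckerBricks.lean`, `TVChk.lagF`,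
`TVChk.nodeVal`) address nodes as `TVChk.nodeVal M u` (the cube point of the binary digits of `u`). They
are the same elements:

* `QBFUniv.bits_elt` — `bits M (GF2.elt M k) = natBits (M+1) k` for `k < 2^{M+1}`;
* **`QBFUniv.elt_eq_nodeVal`**, **`QBFUniv.nodes_eq_nodeVal`** — `nodes n a = nodeVal (Mof n) (a + 1)`.

So the checker's node/basis/interpolation bricks apply to the corrector after the index shift `u = a + 1`.
Everything is proved; no definitions, no named facts.

## References

* [TrevisanVadhan2007] L. Trevisan, S. Vadhan, Comput. Complexity 16 (2007), Thm. 4.3 (proof), Lemma 3.5.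
* R. J. McEliece, *The Theory of Information and Coding*, 2nd ed., CUP 2002, Ch. 9 §9.1 [Mceliece2002]
  (field elements as coefficient tuples), through `GF2StringArith.lean`.
-/

namespace Literature.Computability.Complexity

namespace QBFUniv

open Polynomial GF2Str Literature.InformationTheory.Coding

/-- **The power-basis bits of `elt M k` are the binary digits of `k`** (`k < 2^{M+1}`).
[cite: Mceliece2002, Ch. 9 §9.1] -/
theorem bits_elt (M : ℕ) {k : ℕ} (hk : k < 2 ^ (M + 1)) : bits M (GF2.elt M k) = natBits (M + 1) k := by
  refine bits_eq_of_mk_eq M (p := bitsPoly k) rfl (length_natBits _ _) ?_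
  rw [polyOfBits_natBits hk]
  symm
  refine (modByMonic_eq_self_iff (monic_canonIrred M)).2 ?_
  rw [degree_eq_natDegree (monic_canonIrred M).ne_zero, natDegree_canonIrred]
  exact_mod_cast degree_bitsPoly_lt hk

/-- **`elt M k` is the checker's node `nodeVal M k`** (`k < 2^{M+1}`). [folklore] -/
theorem elt_eq_nodeVal (M : ℕ) {k : ℕ} (hk : k < 2 ^ (M + 1)) : GF2.elt M k = TVChk.nodeVal M k :=
  bits_injective M (by rw [bits_elt M hk, TVChk.natBits_eq_bits_nodeVal])

/-- The corrector's nodes in the checker's addressing: `nodes n a = nodeVal (Mof n) (a + 1)`.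
[cite: TrevisanVadhan2007, Thm. 4.3 (proof)] -/
theorem nodes_eq_nodeVal (n : ℕ) (a : Fin (Dn n + 1)) : nodes n a = TVChk.nodeVal (Mof n) (a.val + 1) := by
  rw [nodes]
  refine elt_eq_nodeVal (Mof n) ?_
  have h1 := (Mof_spec n).2
  have := a.isLt
  omega

end QBFUniv

end Literature.Computability.Complexity
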